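import Summits.QuantumFields.YangMills.Theorems.LangevinControlUVFemtoCurvatureTwoPointStrictRPDefs

/-!
# Crux `FemtoCurvatureTwoPoint` (stmt-QuantumFields-9363, route `LangevinControlUV`):
# strict positivity of the axis covariance, I — the slice Gram kernel and configuration-space infrastructure

Helper for the registered sub-goal `stub_axisPositive` (line `generic-step-gamma-encoding`,
`--supports stmt-QuantumFields-9363`). First properties of the objects of `…StrictRPDefs` on the
configuration space `G^{links}` of the torus `(ℤ/L)^d`:

* the slice Gram kernel is the exponential Gram kernel of its features
  (`sliceKernel_eq_exp_sum`: `K_E = exp(∑ᵢ φᵢ ⊗ φᵢ)`), which are measurable, continuous and bounded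
  by `√β` for unitary `ρ`;
* measure-theoretic infrastructure on the product Haar measure: change of variables along
  measure-preserving maps, resampling a block of links (`integral_eq_integral_integral_splice`), the
  marginal on a block of links (`map_restrict_piMeasure`), continuity of parametric splice integrals
  (second-countable link group), and elementary facts on plaquette functions.

Parts II–VII: `…GramStrict` (Gram expansion), `…SWVanish` (Stone–Weierstrass), `…SliceLemma`,
`…SiteGeometry`, `…SiteTransfer`, `…SiteTransferForm`, `…SiteStrict` (the theorem for even `L`).
Refs: Osterwalder–Seiler, Ann. Phys. 110 (1978) §2; Seiler, LNP 159 (1982) Ch. 2 (transfer matrix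
of lattice gauge theory; here its STRICT positivity for a faithful representation).
-/

set_option autoImplicit false

noncomputable section

namespace Summit.QuantumFields.YangMills.Theorems.FemtoCurvatureTwoPoint.StrictRP

open MeasureTheory Finset
open scoped Matrix ComplexConjugate
open Literature.MathematicalPhysics.QuantumFieldTheory

variable {d L N : ℕ} {G : Type*} [Group G] [TopologicalSpace G] [IsTopologicalGroup G]
  [CompactSpace G] [MeasurableSpace G] [BorelSpace G] (ρ : G →* Matrix (Fin N) (Fin N) ℂ)


omit [TopologicalSpace G] [IsTopologicalGroup G] [CompactSpace G] [MeasurableSpace G]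
  [BorelSpace G] in
/-- The pairing in coordinates: `∑_{a,b} (Re ρ(g)_{ab} Re ρ(h)_{ab} + Im ρ(g)_{ab} Im ρ(h)_{ab})`.
[folklore] -/
theorem pairing_eq_sum (g h : G) :
    pairing ρ g h = ∑ a, ∑ b, ((ρ g a b).re * (ρ h a b).re + (ρ g a b).im * (ρ h a b).im) := by
  unfold pairing
  rw [Matrix.trace]
  simp only [Matrix.diag_apply, Matrix.mul_apply, Matrix.conjTranspose_apply, Complex.re_sum,
    Complex.mul_re, Complex.star_def, Complex.conj_re, Complex.conj_im]
  refine Finset.sum_congr rfl fun a _ => Finset.sum_congr rfl fun b _ => ?_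
  ring




omit [TopologicalSpace G] [IsTopologicalGroup G] [CompactSpace G] [MeasurableSpace G]
  [BorelSpace G] in
/-- The slice Gram kernel is the exponential Gram kernel of the features (`β ≥ 0`). [folklore] -/
theorem sliceKernel_eq_exp_sum {β : ℝ} (hβ : 0 ≤ β) (E : Finset (Edge d L))
    (A W : GaugeConfig d L G) :
    sliceKernel ρ β E A W = Real.exp (∑ i : FeatIndex E N, feature ρ β i A * feature ρ β i W) := by
  unfold sliceKernel
  congr 1
  have hsq : Real.sqrt β * Real.sqrt β = β := Real.mul_self_sqrt hβ
  simp only [FeatIndex, feature, Fintype.sum_prod_type, Fintype.sum_bool, if_true, Bool.false_eq_true,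
    if_false]
  rw [Finset.mul_sum, ← Finset.sum_coe_sort E]
  refine Finset.sum_congr rfl fun e _ => ?_
  rw [pairing_eq_sum, Finset.mul_sum]
  refine Finset.sum_congr rfl fun a _ => ?_
  rw [Finset.mul_sum]
  refine Finset.sum_congr rfl fun b _ => ?_
  linear_combination (-((ρ (A e) a b).re * (ρ (W e) a b).re + (ρ (A e) a b).im * (ρ (W e) a b).im)) * hsq

omit [IsTopologicalGroup G] [CompactSpace G] in
/-- The features are measurable (entry measurability, no second countability needed). [folklore] -/
theorem measurable_feature (hρ : Continuous ρ) (β : ℝ) {E : Finset (Edge d L)} (i : FeatIndex E N) :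
    Measurable (feature ρ β i : GaugeConfig d L G → ℝ) := by
  unfold feature
  have h := WilsonRP.entryMeasurable_apply hρ (i.1 : Edge d L) i.2.1 i.2.2.1
  refine measurable_const.mul ?_
  split_ifs
  · exact Complex.measurable_re.comp h
  · exact Complex.measurable_im.comp h

omit [IsTopologicalGroup G] [CompactSpace G] [MeasurableSpace G] [BorelSpace G] in
/-- The features are continuous. [folklore] -/
theorem continuous_feature (hρ : Continuous ρ) (β : ℝ) {E : Finset (Edge d L)} (i : FeatIndex E N) :
    Continuous (feature ρ β i : GaugeConfig d L G → ℝ) := by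
  unfold feature
  have h : Continuous fun W : GaugeConfig d L G => ρ (W i.1) i.2.1 i.2.2.1 :=
    (hρ.comp (continuous_apply _)).matrix_elem i.2.1 i.2.2.1
  refine continuous_const.mul ?_
  split_ifs
  · exact Complex.continuous_re.comp h
  · exact Complex.continuous_im.comp h

omit [TopologicalSpace G] [IsTopologicalGroup G] [CompactSpace G] [MeasurableSpace G]
  [BorelSpace G] in
/-- The features are bounded by `√β` for a unitary representation. [folklore] -/
theorem abs_feature_le (hunit : ∀ g, ρ g ∈ Matrix.unitaryGroup (Fin N) ℂ) (β : ℝ)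
    {E : Finset (Edge d L)} (i : FeatIndex E N) (W : GaugeConfig d L G) :
    |feature ρ β i W| ≤ Real.sqrt β := by
  unfold feature
  rw [abs_mul, abs_of_nonneg (Real.sqrt_nonneg β)]
  refine mul_le_of_le_one_right (Real.sqrt_nonneg β) ?_
  have h1 := entry_norm_bound_of_unitary (hunit (W i.1)) i.2.1 i.2.2.1
  split_ifs
  · exact (Complex.abs_re_le_norm _).trans h1
  · exact (Complex.abs_im_le_norm _).trans h1

/-! ## Measure-theoretic infrastructure on the configuration space -/

section Infra

variable [NeZero L]

omit [TopologicalSpace G] [IsTopologicalGroup G] [CompactSpace G] [BorelSpace G] in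
/-- Change of variables along a measure-preserving map (real integrands, no embedding
hypothesis). [folklore] -/
theorem integral_comp_eq_of_measurePreserving_real {X Y : Type*} [MeasurableSpace X]
    [MeasurableSpace Y] {ν : Measure X} {ν' : Measure Y} {T : X → Y} (hT : MeasurePreserving T ν ν')
    {Φ : Y → ℝ} (hΦm : Measurable Φ) : ∫ x, Φ (T x) ∂ν = ∫ y, Φ y ∂ν' := by
  rw [← integral_map hT.measurable.aemeasurable hΦm.aestronglyMeasurable, hT.map_eq]

omit [Group G] [IsTopologicalGroup G] [CompactSpace G] [MeasurableSpace G] [BorelSpace G] [NeZero L] in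
/-- The coordinate splice is continuous. [folklore] -/
theorem continuous_splice (C : Finset (Edge d L)) :
    Continuous (LatticeRP.splice C : GaugeConfig d L G × GaugeConfig d L G → GaugeConfig d L G) := by
  classical
  refine continuous_pi fun e => ?_
  simp only [LatticeRP.splice_apply]
  by_cases he : e ∈ C
  · simp only [he, if_true]
    exact (continuous_apply e).comp continuous_snd
  · simp only [he, if_false]
    exact (continuous_apply e).comp continuous_fst

/-- **Resampling a block of coordinates**: `∫ Φ dμ = ∫∫ Φ(splice_C(W, Y)) dμ(Y) dμ(W)` for bounded
measurable real `Φ` (the splice pushes `μ ⊗ μ` to `μ`, then Fubini). [folklore] -/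
theorem integral_eq_integral_integral_splice (C : Finset (Edge d L)) {Φ : GaugeConfig d L G → ℝ}
    (hΦm : Measurable Φ) {K : ℝ} (hΦb : ∀ U, |Φ U| ≤ K) :
    ∫ U, Φ U ∂(LatticeRP.piMeasure (haarProbability G)) =
      ∫ W, ∫ Y, Φ (LatticeRP.splice C (W, Y)) ∂(LatticeRP.piMeasure (haarProbability G))
        ∂(LatticeRP.piMeasure (ι := Edge d L) (haarProbability G)) := by
  classical
  rw [← integral_comp_eq_of_measurePreserving_real
    (LatticeRP.measurePreserving_splice (haarProbability G) C) hΦm]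
  refine integral_prod _ ?_
  exact Integrable.of_bound ((hΦm.comp (LatticeRP.measurable_splice C)).aestronglyMeasurable) K
    (ae_of_all _ fun p => by rw [Real.norm_eq_abs]; exact hΦb _)

omit [TopologicalSpace G] [IsTopologicalGroup G] [CompactSpace G] [BorelSpace G] in
/-- A parametric integral of a jointly measurable real function is measurable in the parameter.
[folklore] -/
theorem measurable_integral_parametric_real {X Y : Type*} [MeasurableSpace X] [MeasurableSpace Y]
    {ν : Measure Y} [SFinite ν] {F : X × Y → ℝ} (hF : Measurable F) :
    Measurable fun x => ∫ y, F (x, y) ∂ν :=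
  (hF.stronglyMeasurable.integral_prod_right').measurable

/-- **Marginal of the product Haar measure on a block of links**: restricting a configuration to
the links of `E` pushes `∏_{all links} dU_e` forward to `∏_{e ∈ E} dU_e`. [folklore] -/
theorem map_restrict_piMeasure (E : Finset (Edge d L)) :
    (LatticeRP.piMeasure (ι := Edge d L) (haarProbability G)).map
        (fun (W : GaugeConfig d L G) (e : ↥E) => W e) =
      Measure.pi fun _ : ↥E => haarProbability G := by
  classical
  have hcomp : (fun (W : GaugeConfig d L G) (e : ↥E) => W e) =
      Prod.fst ∘ (MeasurableEquiv.piEquivPiSubtypeProd (fun _ : Edge d L => G) (· ∈ E)) := by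
    funext W; rfl
  have hmp := measurePreserving_piEquivPiSubtypeProd (fun _ : Edge d L => haarProbability G) (· ∈ E)
  rw [hcomp, ← Measure.map_map measurable_fst (MeasurableEquiv.measurable _)]
  unfold LatticeRP.piMeasure
  rw [hmp.map_eq, ← Measure.fst, Measure.fst_prod]
  have hinst : (Subtype.fintype fun x => x ∈ E) = Finset.Subtype.fintype E := Subsingleton.elim _ _
  rw [hinst]

/-- With a second-countable link group, parametric splice integrals of continuous integrands are
continuous. [folklore] -/
theorem continuous_integral_splice [SecondCountableTopology G] (C : Finset (Edge d L))
    {Φ : GaugeConfig d L G → ℝ} (hΦ : Continuous Φ) :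
    Continuous fun W : GaugeConfig d L G =>
      ∫ Y, Φ (LatticeRP.splice C (W, Y)) ∂(LatticeRP.piMeasure (ι := Edge d L) (haarProbability G)) := by
  have h := continuous_parametric_integral_of_continuous
    (μ := LatticeRP.piMeasure (ι := Edge d L) (haarProbability G))
    (f := fun (W Y : GaugeConfig d L G) => Φ (LatticeRP.splice C (W, Y)))
    (hΦ.comp (continuous_splice C)) isCompact_univ
  simpa only [Measure.restrict_univ] using h

end Infra

/-! ## Plaquette functions -/

section Plaq

omit [CompactSpace G] [MeasurableSpace G] [BorelSpace G] in
/-- The plaquette function `U ↦ Re tr ρ(U_p)` is continuous. [folklore] -/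
theorem continuous_plaqRe (hρ : Continuous ρ) (p : Plaquette d L) :
    Continuous fun U : GaugeConfig d L G => WilsonRP.plaqRe ρ U p := by
  have h : ∀ e : Edge d L, Continuous fun U : GaugeConfig d L G => U e := fun e => continuous_apply e
  unfold WilsonRP.plaqRe plaquetteHolonomy
  refine Complex.continuous_re.comp ((continuous_id.matrix_trace).comp (hρ.comp ?_))
  exact (((h _).mul (h _)).mul ((h _).inv)).mul ((h _).inv)

omit [TopologicalSpace G] [IsTopologicalGroup G] [CompactSpace G] [MeasurableSpace G] [BorelSpace G] in
/-- Resampling links off the plaquette does not change the plaquette function. [folklore] -/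
theorem plaqRe_splice_of_not_mem (C : Finset (Edge d L)) (p : Plaquette d L)
    (h1 : (p.1, p.2.1.1) ∉ C) (h2 : (p.1.shift p.2.1.1, p.2.1.2) ∉ C)
    (h3 : (p.1.shift p.2.1.2, p.2.1.1) ∉ C) (h4 : (p.1, p.2.1.2) ∉ C) (W Y : GaugeConfig d L G) :
    WilsonRP.plaqRe ρ (LatticeRP.splice C (W, Y)) p = WilsonRP.plaqRe ρ W p := by
  unfold WilsonRP.plaqRe plaquetteHolonomy
  simp only [LatticeRP.splice_apply, h1, h2, h3, h4, if_false]

omit [TopologicalSpace G] [IsTopologicalGroup G] [CompactSpace G] [MeasurableSpace G] [BorelSpace G] in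
/-- On the trivial configuration every plaquette function equals `N`. [folklore] -/
theorem plaqRe_one (p : Plaquette d L) :
    WilsonRP.plaqRe ρ (fun _ : Edge d L => (1 : G)) p = N := by
  unfold WilsonRP.plaqRe plaquetteHolonomy
  simp [Matrix.trace_one]

omit [TopologicalSpace G] [IsTopologicalGroup G] [CompactSpace G] [MeasurableSpace G] [BorelSpace G] in
/-- Exciting the first link of a plaquette by `g` (all other links trivial) gives the plaquette
function `Re tr ρ(g)` (`L ≥ 2`, so that the four links are distinct). [folklore] -/
theorem plaqRe_update [Fact (1 < L)] (p : Plaquette d L) (g : G) :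
    WilsonRP.plaqRe ρ (Function.update (fun _ : Edge d L => (1 : G)) (p.1, p.2.1.1) g) p =
      (ρ g).trace.re := by
  classical
  have hij : p.2.1.1 ≠ p.2.1.2 := ne_of_lt p.2.2
  have hshift : p.1.shift p.2.1.2 ≠ p.1 := by
    intro h
    have := congr_fun h p.2.1.2
    rw [Site.shift, Pi.add_apply, Pi.single_eq_same] at this
    exact one_ne_zero (add_eq_left.1 this)
  have e2 : ((p.1.shift p.2.1.1, p.2.1.2) : Edge d L) ≠ (p.1, p.2.1.1) := by
    intro h; exact hij.symm (congrArg Prod.snd h)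
  have e3 : ((p.1.shift p.2.1.2, p.2.1.1) : Edge d L) ≠ (p.1, p.2.1.1) := by
    intro h; exact hshift (congrArg Prod.fst h)
  have e4 : ((p.1, p.2.1.2) : Edge d L) ≠ (p.1, p.2.1.1) := by
    intro h; exact hij.symm (congrArg Prod.snd h)
  unfold WilsonRP.plaqRe plaquetteHolonomy
  rw [Function.update_self, Function.update_of_ne e2, Function.update_of_ne e3,
    Function.update_of_ne e4]
  simp

end Plaq

/-- **Registered sub-goal `stub_sliceMarginal`** (`--supports stmt-QuantumFields-9363`): closed form of `map_restrict_piMeasure` — the marginal of the product Haar measure on a block of links. [folklore] -/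
theorem stub_sliceMarginal : ∀ (d L : ℕ) [NeZero L] (G : Type) [Group G] [TopologicalSpace G] [IsTopologicalGroup G] [CompactSpace G] [MeasurableSpace G] [BorelSpace G] (E : Finset (Literature.MathematicalPhysics.QuantumFieldTheory.Edge d L)), (Literature.MathematicalPhysics.QuantumFieldTheory.LatticeRP.piMeasure (ι := Literature.MathematicalPhysics.QuantumFieldTheory.Edge d L) (Literature.MathematicalPhysics.QuantumFieldTheory.haarProbability G)).map (fun (W : Literature.MathematicalPhysics.QuantumFieldTheory.GaugeConfig d L G) (e : ↥E) => W e) = MeasureTheory.Measure.pi fun _ : ↥E => Literature.MathematicalPhysics.QuantumFieldTheory.haarProbability G := by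
  intro d L _ G _ _ _ _ _ _ E
  exact map_restrict_piMeasure E

end Summit.QuantumFields.YangMills.Theorems.FemtoCurvatureTwoPoint.StrictRP

end
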